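import Mathlib
import Summits.ValiantsHypothesis.ValiantsHypothesis.Theorems.RigidityForcesSymmetryRankRigidMinimalReprLaplaceFiveSectorSplitDefs
import Summits.ValiantsHypothesis.ValiantsHypothesis.Theorems.RigidityForcesSymmetryRankRigidMinimalReprLaplaceFiveSectorSplit
import Summits.ValiantsHypothesis.ValiantsHypothesis.Theorems.RigidityForcesSymmetryRankRigidMinimalReprLaplaceFiveSymmetricPieces
import Summits.ValiantsHypothesis.ValiantsHypothesis.Theorems.RigidityForcesSymmetryRankRigidMinimalReprLaplaceFiveTriangleNoSideSym
import Summits.ValiantsHypothesis.ValiantsHypothesis.Theorems.RigidityForcesSymmetryRankRigidMinimalReprLaplaceFiveThreeSplit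

/-!
# ValiantsHypothesis / RigidityForcesSymmetry — crux `LaplaceOptimalFive` (stmt-ValiantsHypothesis-24813), crux idea
`young-shadow` (K1): **PROP A** — side-symmetric pair decompositions of `P₅` on at most THREE distinct splits weigh `≥ 120`
(`stub_sideSym_threePairSplits` of the sketch, closed by name).

Separation (✓ `twoSplit_separation`, ✓ `LaplaceFiveThreeSplit.threeSplit_separation`) makes every Young shadow fully
slot-symmetric; the catalecticant step (✓ `symmetricPieces_needTen`) then gives `≥ 10` pair terms, i.e. weight `≥ 120`.
In particular the triangle LM-tail profile `3·01 + 3·02 + 3·12` has no side-symmetric solution (✓ `sideSym_triangle_ten_le`).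

Honest framing.  Prop A = K1 on RIGID supports with ≤ 3 pair splits; K1 `SideSymLaplaceOptimalFive` on slack supports (star
`K₁,₄`, `C₄`, `K₃ ⊔ K₂`, ≥ 5 splits), S2′/S3′ of the line, `LaplaceOptimalFive` (OPEN · CONTESTED 72/120), `RankRigidMinimalRepr`,
`VP ≠ VNP` are NOT proved.  No definitions, no `sorry`; Mathlib + tree only.
-/

set_option linter.dupNamespace false

namespace Summit.ValiantsHypothesis.ValiantsHypothesis.Theorems.RigidityForcesSymmetryRankRigidMinimalRepr

namespace LaplaceFivePropA

open Finset LaplaceFiveSectorSplit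

/-- **PROP A (young-shadow K1 on rigid supports).**  A side-symmetric split decomposition of `P₅` by pair terms supported on
at most three distinct pair splits has Laplace weight `≥ 5! = 120`. [folklore] -/
theorem sideSym_threePairSplits (N : ℕ) (T : Finset (Fin N)) (S : Fin N → Finset (Fin 5))
    (u w : Fin N → (Fin 5 → Fin 5) → ℂ) (hdec : IsSplitDecomposition T S u w) (hsym : SideSymmetric T S u w)
    (hpair : ∀ t ∈ T, (S t).card = 2) (h3 : (T.image S).card ≤ 3) :
    Nat.factorial 5 ≤ laplaceWeight T S := by
  classical
  obtain ⟨hu, hw, hid⟩ := hdec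
  -- the shadows
  have hside : ∀ A : Finset (Fin 5),
      SlotInvariantOn A (fun v => ∑ t ∈ T.filter (fun t => S t = A), u t v * w t v)
        ∧ SlotInvariantOn Aᶜ (fun v => ∑ t ∈ T.filter (fun t => S t = A), u t v * w t v) := fun A =>
    ⟨fun τ hτ v => LaplaceFiveTriangleSeparation.shadow_inv_left T S u w hw hsym A τ hτ v,
      fun τ hτ v => LaplaceFiveTriangleSeparation.shadow_inv_right T S u w hu hsym A τ hτ v⟩
  have hfib : ∀ v : Fin 5 → Fin 5, ∑ A ∈ T.image S, ∑ t ∈ T.filter (fun t => S t = A), u t v * w t v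
      = if Function.Injective v then 1 else 0 := by
    intro v
    rw [Finset.sum_fiberwise_of_maps_to (g := S) (fun t (ht : t ∈ T) => Finset.mem_image_of_mem S ht)]
    exact hid v
  have hP : ∀ (τ : Equiv.Perm (Fin 5)) (v : Fin 5 → Fin 5),
      (if Function.Injective (v ∘ ⇑τ) then (1 : ℂ) else 0) = if Function.Injective v then 1 else 0 :=
    fun τ v => if_congr (Equiv.injective_comp τ v) rfl rfl
  have hempty : ∀ A : Finset (Fin 5), A ∉ T.image S → T.filter (fun t => S t = A) = ∅ := by
    intro A hA
    refine Finset.filter_eq_empty_iff.mpr fun t ht h => hA ?_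
    rw [← h]; exact Finset.mem_image_of_mem S ht
  -- every shadow is fully symmetric
  have hsymm : ∀ A : Finset (Fin 5),
      SlotInvariantOn Finset.univ (fun v => ∑ t ∈ T.filter (fun t => S t = A), u t v * w t v) := by
    have hcardI : ∀ A ∈ T.image S, A.card = 2 := by
      intro A hA
      obtain ⟨t, ht, rfl⟩ := Finset.mem_image.mp hA
      exact hpair t ht
    -- shadows off the support vanish
    have off : ∀ A : Finset (Fin 5), A ∉ T.image S →
        SlotInvariantOn Finset.univ (fun v => ∑ t ∈ T.filter (fun t => S t = A), u t v * w t v) := by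
      intro A hA τ _ v
      simp only [hempty A hA, Finset.sum_empty]
    have hk : (T.image S).card = 0 ∨ (T.image S).card = 1 ∨ (T.image S).card = 2 ∨ (T.image S).card = 3 := by omega
    rcases hk with hk | hk | hk | hk
    · intro A; exact off A (by rw [Finset.card_eq_zero.mp hk]; exact Finset.notMem_empty A)
    · obtain ⟨A₁, hI⟩ := Finset.card_eq_one.mp hk
      have on1 : SlotInvariantOn Finset.univ (fun v => ∑ t ∈ T.filter (fun t => S t = A₁), u t v * w t v) := by
        intro τ _ v
        have h1 := hfib v
        have h2 := hfib (v ∘ ⇑τ)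
        rw [hI, Finset.sum_singleton] at h1 h2
        simp only
        rw [h1, h2, hP]
      intro A
      by_cases hA : A ∈ T.image S
      · rw [hI, Finset.mem_singleton] at hA; rw [hA]; exact on1
      · exact off A hA
    · obtain ⟨A₁, A₂, h12, hI⟩ := Finset.card_eq_two.mp hk
      have hs : SlotInvariantOn Finset.univ
          ((fun v => ∑ t ∈ T.filter (fun t => S t = A₁), u t v * w t v)
            + fun v => ∑ t ∈ T.filter (fun t => S t = A₂), u t v * w t v) := by
        intro τ _ v
        have h1 := hfib v
        have h2 := hfib (v ∘ ⇑τ)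
        rw [hI, Finset.sum_pair h12] at h1 h2
        simp only [Pi.add_apply]
        rw [h1, h2, hP]
      obtain ⟨s1, s2⟩ := twoSplit_separation A₁ A₂ (hcardI A₁ (by rw [hI]; simp)) (hcardI A₂ (by rw [hI]; simp)) h12
        _ _ (hside A₁) (hside A₂) hs
      intro A
      by_cases hA : A ∈ T.image S
      · rw [hI, Finset.mem_insert, Finset.mem_singleton] at hA
        rcases hA with rfl | rfl
        · exact s1
        · exact s2
      · exact off A hA
    · obtain ⟨A₁, A₂, A₃, h12, h13, h23, hI⟩ := Finset.card_eq_three.mp hk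
      have hs : SlotInvariantOn Finset.univ
          ((fun v => ∑ t ∈ T.filter (fun t => S t = A₁), u t v * w t v)
            + (fun v => ∑ t ∈ T.filter (fun t => S t = A₂), u t v * w t v)
            + fun v => ∑ t ∈ T.filter (fun t => S t = A₃), u t v * w t v) := by
        intro τ _ v
        have h1 := hfib v
        have h2 := hfib (v ∘ ⇑τ)
        rw [hI, Finset.sum_insert (by simp [h12, h13]), Finset.sum_pair h23] at h1 h2
        simp only [Pi.add_apply]
        rw [hP] at h2
        linear_combination h2 - h1
      obtain ⟨s1, s2, s3⟩ := LaplaceFiveThreeSplit.threeSplit_separation A₁ A₂ A₃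
        (hcardI A₁ (by rw [hI]; simp)) (hcardI A₂ (by rw [hI]; simp)) (hcardI A₃ (by rw [hI]; simp)) h12 h13 h23
        _ _ _ (hside A₁) (hside A₂) (hside A₃) hs
      intro A
      by_cases hA : A ∈ T.image S
      · rw [hI, Finset.mem_insert, Finset.mem_insert, Finset.mem_singleton] at hA
        rcases hA with rfl | rfl | rfl
        · exact s1
        · exact s2
        · exact s3
      · exact off A hA
  -- catalecticant step and weight
  have hten := LaplaceFiveSymmetricPieces.symmetricPieces_needTen N T S u w ⟨hu, hw, hid⟩ hpair
    (fun A τ hτ v => hsymm A τ hτ v)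
  have hwt : laplaceWeight T S = ∑ t ∈ T, 12 := by
    refine Finset.sum_congr rfl fun t ht => ?_
    rw [hpair t ht]; decide
  rw [hwt, Finset.sum_const, smul_eq_mul]
  show 120 ≤ T.card * 12
  omega

end LaplaceFivePropA

end Summit.ValiantsHypothesis.ValiantsHypothesis.Theorems.RigidityForcesSymmetryRankRigidMinimalRepr
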